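import Mathlib
import Literature.Combinatorics.SimpleGraph.PaleyT441M1Fourier
import Literature.Combinatorics.SimpleGraph.PaleyT441M1Squares
import Literature.Combinatorics.SimpleGraph.PaleyT441M1Rows
import HarnessLib

/-!
# Kunisky–Yu `T^{4,4,1}`, step 3: the frequency-one block is `O_C(p^{5/4})` given the FKM estimate — PROVED

Topic `Literature/Combinatorics/SimpleGraph` (support for `kuniskyYu2022_theorem_1_2`).
Assembly of Kunisky–Yu 2022, Theorem 4.20 ("`‖T‖ = O(p^{5/4})`" for
`T_{ij} = ∑_x χ((ix−j)(ix−(j+1))((i+1)x−j)((i+1)x−(j+1)))`), in the form needed for the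
frequency-one block of the pair kernel: for an odd prime `p`, a constant `C ≥ 0` and the
Fouvry–Kowalski–Michel estimate for sums of products of four Kloosterman sums as hypothesis `hFKM`,

  `|∑_{s,t} y_s conj(y_t) ∑_u χ(u)χ(u−t)χ(u+s)χ(u+s−t) e(u/p)| ≤ (2R₀/p)^{1/2} ∑_s |y_s|²`,
  `R₀ = 64p³ + p + (C+8) p³ √p`,

for all `y` with `y_0 = 0` (`norm_paleyKernel_oneFreq_form_le`): the factorisation through
`T⁽¹⁾_{r,t} = K((rt/4)²)K(((1−r)t/4)²)` (`PaleyT441M1Fourier`), the squares fibre and Schur's test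
(`PaleyT441M1Squares`), and the Gershgorin row sums (`PaleyT441M1Rows`).  Since
`(2R₀/p)^{1/2} ≤ (2(C+73))^{1/2} p^{5/4}`, this is the `p^{5/4}` of Theorem 4.20 / Theorem 3.35.

## References

* D. Kunisky, X. Yu, arXiv:2211.02713 (2022), Theorem 4.20, (139).  [KuniskyYu2022]
-/

noncomputable section

open Finset
open Literature.NumberTheory.LFunctions

namespace Literature.Combinatorics.SimpleGraph

section OneFreqAssembly

variable {p : ℕ} [hp : Fact p.Prime]

/-- **Kunisky–Yu 2022, Theorem 4.20 (frequency-one block of `T^{4,4,1}`), given FKM**: for `p`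
odd, `C ≥ 0` and the four-Kloosterman estimate `hFKM`, the frequency-one form is bounded by
`√(2R₀)/√p · ∑_s |y_s|²`, `R₀ = 64p³ + p + (C+8)p³√p`. [cite: KuniskyYu2022, Theorem 4.20] -/
theorem norm_paleyKernel_oneFreq_form_le (hp2 : p ≠ 2) {C : ℝ} (hC : 0 ≤ C)
    (hFKM : ∀ a b c d : ZMod p, a ≠ 0 → b ≠ 0 → c ≠ 0 → d ≠ 0 →
      ¬ ((a = b ∧ c = d) ∨ (a = c ∧ b = d) ∨ (a = d ∧ b = c)) →
      ‖∑ x ∈ (Finset.univ : Finset (ZMod p)).erase 0,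
          kloostermanSum p 1 (a * x) * kloostermanSum p 1 (b * x) *
            kloostermanSum p 1 (c * x) * kloostermanSum p 1 (d * x)‖ ≤
        C * ((p : ℝ) ^ 2 * Real.sqrt p))
    (y : ZMod p → ℂ) (hy : y 0 = 0) :
    ‖∑ s : ZMod p, ∑ t : ZMod p, y s * (starRingEnd ℂ) (y t) *
        ∑ u : ZMod p, ((quadraticChar (ZMod p) u : ℤ) : ℂ) *
          ((quadraticChar (ZMod p) (u - t) : ℤ) : ℂ) *
          ((quadraticChar (ZMod p) (u + s) : ℤ) : ℂ) *
          ((quadraticChar (ZMod p) (u + s - t) : ℤ) : ℂ) * ZMod.stdAddChar u‖ ≤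
      Real.sqrt (2 * (64 * (p : ℝ) ^ 3 + p + (C + 8) * ((p : ℝ) ^ 3 * Real.sqrt p))) /
        Real.sqrt p * ∑ s : ZMod p, ‖y s‖ ^ 2 := by
  set R₀ : ℝ := 64 * (p : ℝ) ^ 3 + p + (C + 8) * ((p : ℝ) ^ 3 * Real.sqrt p) with hR₀
  have hR0 : 0 ≤ R₀ := by positivity
  have hRow := paleyT2_gram_rowSum_le hp2 hC hFKM
  have hsq : ∀ z : ZMod p → ℂ, z 0 = 0 →
      ∑ r : ZMod p, ‖∑ t : ZMod p, z t * kloostermanSum p 1 ((r * t / 4) ^ 2) *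
        kloostermanSum p 1 (((1 - r) * t / 4) ^ 2)‖ ^ 2 ≤ (2 * R₀) * ∑ t : ZMod p, ‖z t‖ ^ 2 :=
    fun z _ => paleyT1_meanSquare_le_of_gram_rowSum_le hp2 hR0 hRow z
  exact norm_paleyKernel_oneFreq_form_le_of_sq_bound hp2 (by positivity) hsq y hy

end OneFreqAssembly

end Literature.Combinatorics.SimpleGraph

end
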